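import Literature.MathematicalPhysics.PowerSystems.LyapunovFunctionFamilyRegionOfAttraction
import HarnessLib

/-!
# Structured and closed-form members of Vu–Turitsyn's Lyapunov functions family

Topic `Literature/MathematicalPhysics/PowerSystems`, namespace
`Literature.MathematicalPhysics.PowerSystems.LyapunovFunctionFamily`. Everything is PROVED (no named
facts). Companion to `LyapunovFunctionFamilyRegionOfAttraction.lean` (`Certificate`,
`Certificate.well_subset_regionOfAttraction`, `System.secondOrder`, `System.swing`,
`System.relativeSwing`) and `LyapunovFunctionFamilyTwoBus.lean` (a hand member for one system).

SOURCE (read on the page). T. L. Vu, K. Turitsyn, IEEE TPWRS 31 (2016) [VuTuritsyn2016]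
(arXiv:1409.1889 chunk p0007), §III: the family is the cone of `(Q, K, H)` with the LMI (QKH)
`[[AᵀQ + QA, R], [Rᵀ, −2H]] ≤ 0`, `R = QB − CᵀH − (KCA)ᵀ`, and «the classical Energy function is
just one element of the large cone of all possible Lyapunov functions corresponding to
K_{kj} = B_kj V_k V_j and Q given by the inertia matrix M». This file makes that remark and its
standard sharpening (energy function plus a cross term) into kernel objects:

* `Certificate.secondOrder_lmiMatrix_eq` — BLOCK ALGEBRA, once: for the second-order structure
  `A = [[0, I], [0, A_d]]`, `B = [0; B_a]`, `C = [E 0]` and a block `Q = [[Q₁₁, Q₁₂], [Q₁₂ᵀ, Q₂₂]]`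
  with `Q₁₁ + Q₁₂A_d = 0`, `Q₁₂B_a = EᵀH`, `Q₂₂B_a = EᵀK`, the LMI matrix IS
  `[[ [[0, 0], [0, S]], 0], [0, −2H]]` with `S = Q₁₂ + Q₁₂ᵀ + A_dᵀQ₂₂ + Q₂₂A_d`; hence
  `Certificate.ofSecondOrder`: such data with `−S ⪰ 0`, `Q − ε·1 ⪰ 0`, `K ≥ 0`, `H > 0` IS a
  certificate — the LMI collapses to the `μ × μ` condition `−S ⪰ 0` (no `(2μ+κ)`-size SDP).
* `Certificate.swingClosedForm` — THE CLOSED-FORM MEMBER for every swing structure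
  `M δ̈ + D δ̇ + EᵀW(sin(δ* + Eθ) − sin δ*) = 0` (infinite-bus form, `M, D, w > 0`): for any
  `0 < c`, `c'` with `c·M_i ≤ c'·D_i`, `Q = [[c·D, c·M], [c·M, c'·M]]` (diagonal blocks),
  `K = c'·w`, `H = c·w` satisfy (QKH) EXACTLY with `S = 2(c·M − c'·D) ≤ 0` and `R = 0`; its
  Lyapunov function is `c'·(energy) + c·(ωᵀMθ + ½θᵀDθ)` — the energy function with a cross term.
  `swingClosedForm_V_eq` writes `V` out. Consequently — `swingClosedForm_well_subset_regionOfAttraction`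
  — `Certificate.well_subset_regionOfAttraction` applies to EVERY lossless classical
  multimachine-infinite-bus system with NO semidefinite programming at all: given `ker E = 0`,
  `|δ*_k| < π/2` and rationals `c, c', ε` passing `3n` scalar inequalities, for every
  `c₀ < V(0) + min_k c'·w_k·(2cos δ*_k − (π − 2|δ*_k|) sin|δ*_k|)` the set `{x ∈ 𝒫 : V(x) ≤ c₀}` is
  positively invariant and every global solution from it tends to the equilibrium.

* `Certificate.relativeClosedForm` — THE CLOSED-FORM MEMBER for the relative form
  `System.relativeSwing` (reference machine, uniform damping `λ`, no bus; `B_a = N EᵀW`,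
  `N = M⁻¹ + M_ref⁻¹𝟙𝟙ᵀ`): with an exact symmetric inverse `N⁻¹ ⪰ ν·1` as data,
  `Q = [[λc·N⁻¹, c·N⁻¹], [c·N⁻¹, c'·N⁻¹]]`, `K = c'·w`, `H = c·w`, `ε = ν·g` satisfy (QKH)
  exactly (`S = 2(c − λc')N⁻¹`, `R = 0`) under `0 < c ≤ λc'`, `0 < g < λc`,
  `c² ≤ (λc − g)(c' − g)`; `relativeClosedForm_well_subset_regionOfAttraction` is the certified
  synchronization region — the no-bus benchmark class under uniform damping needs NO SDP either.

* `Certificate.face_of_zero_firstColumn`, `secondOrder_face_input`, `secondOrder_face_state` —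
  **`ofSecondOrder` IS CANONICAL**: for EVERY certificate of a second-order object the structural
  hypotheses `Q₁₂B_a = EᵀH` and `Q₁₁ + Q₁₂A_d = 0` HOLD (the `(x₁, x₁)` block of `AᵀQ + QA` is
  zero, so positive semidefiniteness kills the whole `x₁`-rows of the LMI matrix): the family's LMI
  is feasible only on this face — the free data are `Q₂₂`, `K`, `ε`, and a producer must round ON
  the face (solve the face equations exactly, then round the rest).

THREE COLUMNS. CERTIFIED: the statements below (kernel objects about the printed ODE class (3)).
COMPUTED: nothing. VALIDATED: nothing. MODELLED (outside): as in the companion files.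
-/

noncomputable section

open Real Set Filter Matrix Finset
open scoped Topology

namespace Literature.MathematicalPhysics.PowerSystems.LyapunovFunctionFamily

variable {κ : Type*} [Fintype κ] [DecidableEq κ]
variable {μ : Type*} [Fintype μ] [DecidableEq μ]

/-! ### Private linear-algebra plumbing -/

/-- A real matrix with `Mᵀ = M` and a non-negative quadratic form is positive semidefinite
(private plumbing). [folklore] -/
private theorem posSemidef_of_transpose_of_nonneg' {n : Type*} [Fintype n] {P : Matrix n n ℝ}
    (hsymm : Pᵀ = P) (h : ∀ x : n → ℝ, 0 ≤ x ⬝ᵥ (P *ᵥ x)) : P.PosSemidef := by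
  refine Matrix.PosSemidef.of_dotProduct_mulVec_nonneg ?_ fun x => ?_
  · rw [Matrix.IsHermitian, Matrix.conjTranspose_eq_transpose_of_trivial]
    exact hsymm
  · rw [star_trivial]
    exact h x

omit [DecidableEq κ] [DecidableEq μ] in
/-- `z ⬝ Sum.elim a b = z∘inl ⬝ a + z∘inr ⬝ b` (private plumbing). [folklore] -/
private theorem dotProduct_sumElim (z : μ ⊕ κ → ℝ) (a : μ → ℝ) (b : κ → ℝ) :
    z ⬝ᵥ Sum.elim a b = (z ∘ Sum.inl) ⬝ᵥ a + (z ∘ Sum.inr) ⬝ᵥ b := by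
  simp [dotProduct, Fintype.sum_sum_type]

omit [DecidableEq κ] [DecidableEq μ] in
/-- A block-diagonal matrix with positive semidefinite diagonal blocks is positive semidefinite
(private plumbing). [folklore] -/
private theorem posSemidef_fromBlocks_diag {X : Matrix μ μ ℝ} {Y : Matrix κ κ ℝ}
    (hX : X.PosSemidef) (hY : Y.PosSemidef) : (Matrix.fromBlocks X 0 0 Y).PosSemidef := by
  have hXs : Xᵀ = X := by
    have := hX.isHermitian
    rw [Matrix.IsHermitian, Matrix.conjTranspose_eq_transpose_of_trivial] at this
    exact this
  have hYs : Yᵀ = Y := by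
    have := hY.isHermitian
    rw [Matrix.IsHermitian, Matrix.conjTranspose_eq_transpose_of_trivial] at this
    exact this
  refine posSemidef_of_transpose_of_nonneg' ?_ fun z => ?_
  · rw [Matrix.fromBlocks_transpose, Matrix.transpose_zero, Matrix.transpose_zero, hXs, hYs]
  · rw [Matrix.fromBlocks_mulVec, dotProduct_sumElim]
    simp only [Matrix.zero_mulVec, add_zero, zero_add]
    have h1 := hX.dotProduct_mulVec_nonneg (z ∘ Sum.inl)
    have h2 := hY.dotProduct_mulVec_nonneg (z ∘ Sum.inr)
    rw [star_trivial] at h1 h2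
    exact add_nonneg h1 h2

/-! ### The LMI of a second-order structure with a structured `Q` collapses -/

namespace Certificate

/-- **Block algebra of (QKH) for the second-order structure.** For `A = [[0, I], [0, A_d]]`,
`B = [0; B_a]`, `C = [E 0]`, `Q = [[Q₁₁, Q₁₂], [Q₁₂ᵀ, Q₂₂]]` with `Q₁₁ᵀ = Q₁₁`,
`Q₁₁ + Q₁₂A_d = 0`, `Q₁₂B_a = EᵀH`, `Q₂₂B_a = EᵀK`: `AᵀQ + QA = [[0, 0], [0, S]]` with
`S = Q₁₂ + Q₁₂ᵀ + A_dᵀQ₂₂ + Q₂₂A_d`, and `R = QB − CᵀH − (KCA)ᵀ = 0`, so the LMI matrix is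
`[[ [[0,0],[0,S]], 0], [0, −2H]]`. [cite: VuTuritsyn2016, §III eq. (QKH) (evaluated on §II eq. (3))] -/
theorem secondOrder_lmiMatrix_eq (Ad : Matrix μ μ ℝ) (Ba : Matrix μ κ ℝ) (E : Matrix κ μ ℝ)
    (δs : κ → ℝ) (Q₁₁ Q₁₂ Q₂₂ : Matrix μ μ ℝ) (kK h : κ → ℝ) (h11 : Q₁₁ᵀ = Q₁₁)
    (h1 : Q₁₁ + Q₁₂ * Ad = 0) (h2 : Q₁₂ * Ba = Eᵀ * Matrix.diagonal h)
    (h3 : Q₂₂ * Ba = Eᵀ * Matrix.diagonal kK) :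
    Matrix.fromBlocks
        ((System.secondOrder Ad Ba E δs).Aᵀ * Matrix.fromBlocks Q₁₁ Q₁₂ Q₁₂ᵀ Q₂₂
          + Matrix.fromBlocks Q₁₁ Q₁₂ Q₁₂ᵀ Q₂₂ * (System.secondOrder Ad Ba E δs).A)
        (Matrix.fromBlocks Q₁₁ Q₁₂ Q₁₂ᵀ Q₂₂ * (System.secondOrder Ad Ba E δs).B
          - (System.secondOrder Ad Ba E δs).Cᵀ * Matrix.diagonal h
          - (Matrix.diagonal kK * (System.secondOrder Ad Ba E δs).C
              * (System.secondOrder Ad Ba E δs).A)ᵀ)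
        (Matrix.fromBlocks Q₁₁ Q₁₂ Q₁₂ᵀ Q₂₂ * (System.secondOrder Ad Ba E δs).B
          - (System.secondOrder Ad Ba E δs).Cᵀ * Matrix.diagonal h
          - (Matrix.diagonal kK * (System.secondOrder Ad Ba E δs).C
              * (System.secondOrder Ad Ba E δs).A)ᵀ)ᵀ
        (-(2 : ℝ) • Matrix.diagonal h)
      = Matrix.fromBlocks (Matrix.fromBlocks 0 0 0 (Q₁₂ + Q₁₂ᵀ + Adᵀ * Q₂₂ + Q₂₂ * Ad)) 0 0
          (-(2 : ℝ) • Matrix.diagonal h) := by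
  have hA : (System.secondOrder Ad Ba E δs).A = Matrix.fromBlocks 0 1 0 Ad := rfl
  have hB : (System.secondOrder Ad Ba E δs).B = Matrix.fromRows 0 Ba := rfl
  have hC : (System.secondOrder Ad Ba E δs).C = Matrix.fromCols E 0 := rfl
  have h1t : Q₁₁ + Adᵀ * Q₁₂ᵀ = 0 := by
    have := congrArg Matrix.transpose h1
    rwa [Matrix.transpose_add, Matrix.transpose_mul, h11, Matrix.transpose_zero] at this
  have hP : (System.secondOrder Ad Ba E δs).Aᵀ * Matrix.fromBlocks Q₁₁ Q₁₂ Q₁₂ᵀ Q₂₂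
      + Matrix.fromBlocks Q₁₁ Q₁₂ Q₁₂ᵀ Q₂₂ * (System.secondOrder Ad Ba E δs).A
      = Matrix.fromBlocks 0 0 0 (Q₁₂ + Q₁₂ᵀ + Adᵀ * Q₂₂ + Q₂₂ * Ad) := by
    rw [hA, Matrix.fromBlocks_transpose, Matrix.transpose_zero,
      Matrix.transpose_one, Matrix.fromBlocks_multiply, Matrix.fromBlocks_multiply,
      Matrix.fromBlocks_add]
    simp only [Matrix.zero_mul, Matrix.mul_zero, Matrix.one_mul, Matrix.mul_one, add_zero,
      zero_add]
    rw [h1, h1t]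
    congr 1
    abel
  have hR : Matrix.fromBlocks Q₁₁ Q₁₂ Q₁₂ᵀ Q₂₂ * (System.secondOrder Ad Ba E δs).B
      - (System.secondOrder Ad Ba E δs).Cᵀ * Matrix.diagonal h
      - (Matrix.diagonal kK * (System.secondOrder Ad Ba E δs).C
          * (System.secondOrder Ad Ba E δs).A)ᵀ = 0 := by
    rw [hA, hB, hC, Matrix.fromBlocks_mul_fromRows, Matrix.transpose_fromCols,
      Matrix.fromRows_mul, Matrix.mul_fromCols, Matrix.fromCols_mul_fromBlocks,
      Matrix.transpose_fromCols]
    simp only [Matrix.zero_mul, Matrix.mul_zero, Matrix.mul_one, add_zero, zero_add,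
      Matrix.transpose_zero, Matrix.transpose_mul, Matrix.diagonal_transpose, h2, h3]
    ext (i | i) j <;> simp [Matrix.fromRows]
  rw [hP, hR, Matrix.transpose_zero]

/-- **A structured certificate for a second-order structure.** Data `Q₁₁, Q₁₂, Q₂₂` (`μ × μ`),
`K, H` (per line), `ε`, with `Q₁₁, Q₂₂` symmetric, `Q₁₁ + Q₁₂A_d = 0`, `Q₁₂B_a = EᵀH`,
`Q₂₂B_a = EᵀK`, `−(Q₁₂ + Q₁₂ᵀ + A_dᵀQ₂₂ + Q₂₂A_d) ⪰ 0`, `[[Q₁₁, Q₁₂],[Q₁₂ᵀ, Q₂₂]] − ε·1 ⪰ 0`,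
`ε > 0`, `K ≥ 0`, `H > 0` IS a member of the family with its certified lower bound: the LMI (QKH)
holds by `secondOrder_lmiMatrix_eq`. [cite: VuTuritsyn2016, §III eq. (QKH)] -/
def ofSecondOrder (Ad : Matrix μ μ ℝ) (Ba : Matrix μ κ ℝ) (E : Matrix κ μ ℝ) (δs : κ → ℝ)
    (Q₁₁ Q₁₂ Q₂₂ : Matrix μ μ ℝ) (kK h : κ → ℝ) (ε : ℝ) (h11 : Q₁₁ᵀ = Q₁₁) (h22 : Q₂₂ᵀ = Q₂₂)
    (h1 : Q₁₁ + Q₁₂ * Ad = 0) (h2 : Q₁₂ * Ba = Eᵀ * Matrix.diagonal h)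
    (h3 : Q₂₂ * Ba = Eᵀ * Matrix.diagonal kK)
    (hS : (-(Q₁₂ + Q₁₂ᵀ + Adᵀ * Q₂₂ + Q₂₂ * Ad)).PosSemidef) (hε : 0 < ε)
    (hQε : (Matrix.fromBlocks Q₁₁ Q₁₂ Q₁₂ᵀ Q₂₂
      - ε • (1 : Matrix (μ ⊕ μ) (μ ⊕ μ) ℝ)).PosSemidef)
    (hK : ∀ k, 0 ≤ kK k) (hh : ∀ k, 0 < h k) : Certificate (System.secondOrder Ad Ba E δs) where
  Q := Matrix.fromBlocks Q₁₁ Q₁₂ Q₁₂ᵀ Q₂₂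
  kK := kK
  h := h
  ε := ε
  Q_symm := by
    rw [Matrix.fromBlocks_transpose, Matrix.transpose_transpose, h11, h22]
  ε_pos := hε
  Q_ge := hQε
  kK_nonneg := hK
  h_pos := hh
  lmi := by
    rw [secondOrder_lmiMatrix_eq Ad Ba E δs Q₁₁ Q₁₂ Q₂₂ kK h h11 h1 h2 h3, Matrix.fromBlocks_neg,
      Matrix.fromBlocks_neg]
    simp only [neg_zero, neg_smul, neg_neg]
    refine posSemidef_fromBlocks_diag (posSemidef_fromBlocks_diag Matrix.PosSemidef.zero hS) ?_
    rw [← Matrix.diagonal_smul]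
    refine Matrix.PosSemidef.diagonal fun k => ?_
    simp only [Pi.smul_apply, smul_eq_mul, Pi.zero_apply]
    exact mul_nonneg (by norm_num) (hh k).le

end Certificate

/-! ### The closed-form member for every swing structure (energy function with a cross term) -/

/-- `a u² + 2 b u v + d v² ≥ 0` when `a > 0` and `a d ≥ b²` (private plumbing). [folklore] -/
private theorem quadForm₂_nonneg' {a b d : ℝ} (ha : 0 < a) (had : b ^ 2 ≤ a * d) (u v : ℝ) :
    0 ≤ a * u ^ 2 + 2 * b * u * v + d * v ^ 2 := by
  have key : a * (a * u ^ 2 + 2 * b * u * v + d * v ^ 2)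
      = (a * u + b * v) ^ 2 + (a * d - b ^ 2) * v ^ 2 := by ring
  nlinarith [sq_nonneg (a * u + b * v), sq_nonneg v, key]

namespace Certificate

/-- **The closed-form member of the family for every swing structure** (classical multimachine–
infinite-bus model `M θ̈ + D θ̇ + EᵀW(sin(δ* + Eθ) − sin δ*) = 0`, `M, w > 0`): for `0 < c` and `c'`
with `c·M_i ≤ c'·D_i` for all machines, the data `Q = [[c·D, c·M], [c·M, c'·M]]` (diagonal
blocks), `K = c'·w`, `H = c·w` satisfy the LMI (QKH) exactly — `Q₁₁ + Q₁₂A_d = cD − cM·M⁻¹D = 0`,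
`Q₁₂B_a = cM·M⁻¹EᵀW = EᵀH`, `Q₂₂B_a = c'EᵀW = EᵀK`, `S = 2(cM − c'D) ≤ 0` — and `Q − ε·1 ⪰ 0`
for every `ε > 0` with `ε < c·D_i` and `(c·M_i)² ≤ (c·D_i − ε)(c'·M_i − ε)` (e.g. any
`ε ≤ c·M_i(c'·D_i − c·M_i)/(c·D_i + c'·M_i)` when `c·M_i < c'·D_i`). Its Lyapunov function is
`V = ½(c·θᵀDθ + 2c·θᵀMω + c'·ωᵀMω) − c'·Σ_k w_k(cos(δ*_k + (Eθ)_k) + (δ*_k + (Eθ)_k) sin δ*_k)`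
= `c'`·(energy function) + `c`·(cross term `ωᵀMθ + ½θᵀDθ`): the printed remark that the energy
function (`Q` = inertia matrix, `K = W`) lies in the cone, sharpened by the cross term that makes
`Q` positive definite. NO semidefinite programming is needed to use
`Certificate.well_subset_regionOfAttraction` on this class: `c, c', ε` rational and `3n` scalar
inequalities. [cite: VuTuritsyn2016, §III eq. (QKH) and the remark after eq. (Lyapunov) («the classical Energy function is just one element of the large cone … Q given by the inertia matrix M»)] -/
def swingClosedForm {n : ℕ} (M D : Fin n → ℝ) (E : Matrix κ (Fin n) ℝ) (w : κ → ℝ)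
    (δs : κ → ℝ) (c c' ε : ℝ) (hM : ∀ i, 0 < M i) (hw : ∀ k, 0 < w k) (hc : 0 < c)
    (hc' : 0 ≤ c') (hcc' : ∀ i, c * M i ≤ c' * D i) (hε : 0 < ε) (hε1 : ∀ i, ε < c * D i)
    (hε2 : ∀ i, (c * M i) ^ 2 ≤ (c * D i - ε) * (c' * M i - ε)) :
    Certificate (System.swing M D E w δs) :=
  show Certificate (System.secondOrder (-Matrix.diagonal fun i => D i / M i)
      (Matrix.diagonal (fun i => 1 / M i) * Eᵀ * Matrix.diagonal w) E δs) from
  ofSecondOrder (-Matrix.diagonal fun i => D i / M i)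
    (Matrix.diagonal (fun i => 1 / M i) * Eᵀ * Matrix.diagonal w) E δs
    (c • Matrix.diagonal D) (c • Matrix.diagonal M) (c' • Matrix.diagonal M)
    (fun k => c' * w k) (fun k => c * w k) ε
    (by rw [Matrix.transpose_smul, Matrix.diagonal_transpose])
    (by rw [Matrix.transpose_smul, Matrix.diagonal_transpose])
    (by
      have e : Matrix.diagonal M * Matrix.diagonal (fun i => D i / M i) = Matrix.diagonal D := by
        rw [Matrix.diagonal_mul_diagonal]
        congr 1
        funext i
        field_simp [(hM i).ne']
      rw [Matrix.mul_neg, smul_mul_assoc, e]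
      exact add_neg_cancel _)
    (by
      have e1 : Matrix.diagonal M * Matrix.diagonal (fun i => 1 / M i) = 1 := by
        rw [Matrix.diagonal_mul_diagonal, ← Matrix.diagonal_one]
        congr 1
        funext i
        field_simp [(hM i).ne']
      have e2 : (Matrix.diagonal fun k => c * w k) = c • Matrix.diagonal w := by
        rw [← Matrix.diagonal_smul]
        rfl
      rw [Matrix.smul_mul, ← Matrix.mul_assoc, ← Matrix.mul_assoc, e1, Matrix.one_mul, e2,
        Matrix.mul_smul])
    (by
      have e1 : Matrix.diagonal M * Matrix.diagonal (fun i => 1 / M i) = 1 := by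
        rw [Matrix.diagonal_mul_diagonal, ← Matrix.diagonal_one]
        congr 1
        funext i
        field_simp [(hM i).ne']
      have e2 : (Matrix.diagonal fun k => c' * w k) = c' • Matrix.diagonal w := by
        rw [← Matrix.diagonal_smul]
        rfl
      rw [Matrix.smul_mul, ← Matrix.mul_assoc, ← Matrix.mul_assoc, e1, Matrix.one_mul, e2,
        Matrix.mul_smul])
    (by
      have e : -(c • Matrix.diagonal M + (c • Matrix.diagonal M)ᵀ
          + (-Matrix.diagonal fun i => D i / M i)ᵀ * (c' • Matrix.diagonal M)
          + c' • Matrix.diagonal M * -Matrix.diagonal fun i => D i / M i)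
          = Matrix.diagonal fun i => 2 * (c' * D i - c * M i) := by
        have e3 : Matrix.diagonal (fun i => D i / M i) * Matrix.diagonal M = Matrix.diagonal D := by
          rw [Matrix.diagonal_mul_diagonal]
          congr 1
          funext i
          field_simp [(hM i).ne']
        have e4 : Matrix.diagonal M * Matrix.diagonal (fun i => D i / M i) = Matrix.diagonal D := by
          rw [Matrix.diagonal_mul_diagonal]
          congr 1
          funext i
          field_simp [(hM i).ne']
        rw [Matrix.transpose_smul, Matrix.diagonal_transpose, Matrix.transpose_neg,
          Matrix.diagonal_transpose, Matrix.neg_mul, Matrix.mul_neg, Matrix.mul_smul,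
          Matrix.smul_mul, e3, e4]
        ext i j
        by_cases hij : i = j
        · subst hij
          simp [Matrix.diagonal_apply_eq]
          ring
        · simp [Matrix.diagonal_apply_ne _ hij]
      rw [e]
      exact Matrix.PosSemidef.diagonal fun i => by
        have := hcc' i
        simp only [Pi.zero_apply]
        linarith)
    hε
    (by
      refine posSemidef_of_transpose_of_nonneg' ?_ fun z => ?_
      · simp only [Matrix.transpose_sub, Matrix.transpose_smul, Matrix.transpose_one,
          Matrix.fromBlocks_transpose, Matrix.diagonal_transpose]
      · have e : z ⬝ᵥ ((Matrix.fromBlocks (c • Matrix.diagonal D) (c • Matrix.diagonal M)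
            (c • Matrix.diagonal M)ᵀ (c' • Matrix.diagonal M)
            - ε • (1 : Matrix (Fin n ⊕ Fin n) (Fin n ⊕ Fin n) ℝ)) *ᵥ z)
            = ∑ i, ((c * D i - ε) * z (Sum.inl i) ^ 2
                + 2 * (c * M i) * z (Sum.inl i) * z (Sum.inr i)
                + (c' * M i - ε) * z (Sum.inr i) ^ 2) := by
          rw [Matrix.transpose_smul, Matrix.diagonal_transpose, Matrix.sub_mulVec,
            Matrix.smul_mulVec, Matrix.one_mulVec, Matrix.fromBlocks_mulVec, dotProduct_sub,
            dotProduct_sumElim, dotProduct_smul]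
          simp only [Matrix.smul_mulVec, dotProduct, Pi.add_apply,
            Pi.smul_apply, Matrix.mulVec_diagonal, Function.comp_apply, smul_eq_mul,
            Fintype.sum_sum_type]
          have resh : ∀ f g h k : Fin n → ℝ, (∑ i, f i) + (∑ i, g i) - ε * ((∑ i, h i) + ∑ i, k i)
              = ∑ i, (f i + g i - ε * (h i + k i)) := by
            intro f g h k
            simp only [Finset.sum_add_distrib, Finset.sum_sub_distrib, Finset.mul_sum, mul_add]
          rw [resh]
          refine Finset.sum_congr rfl fun i _ => ?_
          ring
        rw [e]
        exact Finset.sum_nonneg fun i _ =>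
          quadForm₂_nonneg' (by linarith [hε1 i]) (hε2 i) (z (Sum.inl i)) (z (Sum.inr i)))
    (fun k => mul_nonneg hc' (hw k).le) (fun k => mul_pos hc (hw k))

end Certificate

namespace Certificate

open ClassicalModel.LosslessSystem (vtGap)

/-- **Solver-free certified region of attraction for every lossless multimachine–infinite-bus
system.** For the swing structure `M θ̈ + D θ̇ + EᵀW(sin(δ* + Eθ) − sin δ*) = 0` with `M, w > 0`,
`ker E = 0`, `|δ*_k| < π/2`, and rationals `c > 0`, `c' ≥ 0`, `ε > 0` with `c·M_i ≤ c'·D_i`,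
`ε < c·D_i`, `(c·M_i)² ≤ (c·D_i − ε)(c'·M_i − ε)` (machine by machine): with `V` the closed-form
member's Lyapunov function (`Certificate.swingClosedForm`), for every
`c₀ < V(0) + min_k c'·w_k·vtGap(δ*_k)` the set `{x ∈ 𝒫 : V(x) ≤ c₀}` is positively invariant and
every global solution from it tends to the equilibrium. CERTIFIED; only scalar inequalities on the
data remain for an instance. [cite: VuTuritsyn2016, §III eq. (QKH) with §IV (set ℛ, third construction)] -/
theorem swingClosedForm_well_subset_regionOfAttraction {n : ℕ} (M D : Fin n → ℝ)
    (E : Matrix κ (Fin n) ℝ) (w : κ → ℝ) (δs : κ → ℝ) (c c' ε : ℝ) (hM : ∀ i, 0 < M i)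
    (hw : ∀ k, 0 < w k) (hc : 0 < c) (hc' : 0 ≤ c') (hcc' : ∀ i, c * M i ≤ c' * D i) (hε : 0 < ε)
    (hε1 : ∀ i, ε < c * D i) (hε2 : ∀ i, (c * M i) ^ 2 ≤ (c * D i - ε) * (c' * M i - ε))
    (hE : ∀ v : Fin n → ℝ, E *ᵥ v = 0 → v = 0) (hδs : ∀ k, |δs k| < π / 2) {c₀ : ℝ}
    (hc₀ : ∀ k, c₀ < (swingClosedForm M D E w δs c c' ε hM hw hc hc' hcc' hε hε1 hε2).V 0
      + c' * w k * vtGap (δs k))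
    {y : Fin n ⊕ Fin n → ℝ} (hy : y ∈ (System.swing M D E w δs).polytope)
    (hyc : (swingClosedForm M D E w δs c c' ε hM hw hc hc' hcc' hε hε1 hε2).V y ≤ c₀) :
    (∃ X : ℝ → Fin n ⊕ Fin n → ℝ, X 0 = y ∧
        ∀ T : ℝ, ∀ t ∈ Icc 0 T,
          HasDerivWithinAt X ((System.swing M D E w δs).field (X t)) (Icc 0 T) t) ∧
      ∀ X : ℝ → Fin n ⊕ Fin n → ℝ, X 0 = y →
        (∀ T : ℝ, ∀ t ∈ Icc 0 T,
          HasDerivWithinAt X ((System.swing M D E w δs).field (X t)) (Icc 0 T) t) →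
        (∀ t, 0 ≤ t → X t ∈ (System.swing M D E w δs).polytope ∧
            (swingClosedForm M D E w δs c c' ε hM hw hc hc' hcc' hε hε1 hε2).V (X t) ≤ c₀) ∧
          Tendsto X atTop (𝓝 0) :=
  (swingClosedForm M D E w δs c c' ε hM hw hc hc' hcc' hε hε1 hε2).well_subset_regionOfAttraction_of_gap₀
    (System.swing_C_mul_B M D E w δs) hδs (System.swing_obs M D E w δs hE) hc₀ hy hyc

/-- The closed-form member's Lyapunov function, written out:
`V(θ, ω) = ½ Σ_i (c·D_i θ_i² + 2c·M_i θ_i ω_i + c'·M_i ω_i²)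
  − Σ_k c'·w_k (cos(δ*_k + (Eθ)_k) + (δ*_k + (Eθ)_k) sin δ*_k)` — `c'`·energy + `c`·cross term.
[cite: VuTuritsyn2016, §III eq. (Lyapunov)] -/
theorem swingClosedForm_V_eq {n : ℕ} (M D : Fin n → ℝ) (E : Matrix κ (Fin n) ℝ) (w : κ → ℝ)
    (δs : κ → ℝ) (c c' ε : ℝ) (hM : ∀ i, 0 < M i) (hw : ∀ k, 0 < w k) (hc : 0 < c)
    (hc' : 0 ≤ c') (hcc' : ∀ i, c * M i ≤ c' * D i) (hε : 0 < ε) (hε1 : ∀ i, ε < c * D i)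
    (hε2 : ∀ i, (c * M i) ^ 2 ≤ (c * D i - ε) * (c' * M i - ε)) (x : Fin n ⊕ Fin n → ℝ) :
    (swingClosedForm M D E w δs c c' ε hM hw hc hc' hcc' hε hε1 hε2).V x
      = (1 / 2) * ∑ i, (c * D i * x (Sum.inl i) ^ 2 + 2 * (c * M i) * x (Sum.inl i) * x (Sum.inr i)
          + c' * M i * x (Sum.inr i) ^ 2)
        - ∑ k, c' * w k * (Real.cos (δs k + (E *ᵥ (x ∘ Sum.inl)) k)
          + (δs k + (E *ᵥ (x ∘ Sum.inl)) k) * Real.sin (δs k)) := by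
  have hC : (System.swing M D E w δs).C *ᵥ x = E *ᵥ (x ∘ Sum.inl) := System.swing_C_mulVec M D E w δs x
  unfold Certificate.V
  rw [hC]
  congr 1
  show (1 / 2 : ℝ) * (x ⬝ᵥ (Matrix.fromBlocks (c • Matrix.diagonal D) (c • Matrix.diagonal M)
      (c • Matrix.diagonal M)ᵀ (c' • Matrix.diagonal M) *ᵥ x)) = _
  rw [Matrix.transpose_smul, Matrix.diagonal_transpose, Matrix.fromBlocks_mulVec,
    dotProduct_sumElim]
  simp only [Matrix.smul_mulVec, dotProduct, Pi.add_apply, Pi.smul_apply,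
    Matrix.mulVec_diagonal, Function.comp_apply, smul_eq_mul, ← Finset.sum_add_distrib]
  congr 1
  refine Finset.sum_congr rfl fun i _ => ?_
  ring

end Certificate

/-! ### The closed-form member for the relative (reference-machine, uniform-damping) form -/

omit [DecidableEq μ] in
/-- Bilinear expansion `(s a + t b)ᵀP(s a + t b) = s² aᵀPa + 2st aᵀPb + t² bᵀPb` for symmetric
`P` (private plumbing). [folklore] -/
private theorem quad_expand {P : Matrix μ μ ℝ} (hP : Pᵀ = P) (a b : μ → ℝ) (s t : ℝ) :
    (s • a + t • b) ⬝ᵥ (P *ᵥ (s • a + t • b))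
      = s ^ 2 * (a ⬝ᵥ (P *ᵥ a)) + 2 * s * t * (a ⬝ᵥ (P *ᵥ b)) + t ^ 2 * (b ⬝ᵥ (P *ᵥ b)) := by
  have sym : b ⬝ᵥ (P *ᵥ a) = a ⬝ᵥ (P *ᵥ b) := by
    rw [Matrix.dotProduct_mulVec, ← Matrix.mulVec_transpose, hP, dotProduct_comm]
  simp only [Matrix.mulVec_add, Matrix.mulVec_smul, dotProduct_add, add_dotProduct,
    smul_dotProduct, dotProduct_smul, smul_eq_mul, sym]
  ring

omit [DecidableEq κ] [DecidableEq μ] in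
/-- `z ⬝ z = z∘inl ⬝ z∘inl + z∘inr ⬝ z∘inr` on a sum type (private plumbing). [folklore] -/
private theorem dotProduct_self_sum (z : μ ⊕ κ → ℝ) :
    z ⬝ᵥ z = (z ∘ Sum.inl) ⬝ᵥ (z ∘ Sum.inl) + (z ∘ Sum.inr) ⬝ᵥ (z ∘ Sum.inr) := by
  simp [dotProduct, Fintype.sum_sum_type]

namespace Certificate

/-- **The closed-form member of the family for the relative form** `System.relativeSwing`
(classical model in angles relative to a reference machine, uniform damping `λ`, no infinite bus;
`B_a = N EᵀW` with `N = M⁻¹ + M_ref⁻¹𝟙𝟙ᵀ`). Data: an exact inverse `N⁻¹` (`N⁻¹N = 1`,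
symmetric, `N⁻¹ − ν·1 ⪰ 0` for some `ν > 0`) and scalars `0 < c ≤ λc'`, `0 < g < λc` with
`c² ≤ (λc − g)(c' − g)`. Then `Q = [[λc·N⁻¹, c·N⁻¹], [c·N⁻¹, c'·N⁻¹]]`, `K = c'·w`, `H = c·w`,
`ε = ν·g` satisfy (QKH) EXACTLY: `Q₁₁ + Q₁₂A_d = λcN⁻¹ − λcN⁻¹ = 0`, `Q₁₂B_a = cEᵀW`,
`Q₂₂B_a = c'EᵀW`, `−S = 2(λc' − c)N⁻¹ ⪰ 0`, and `Q − νg·1 ⪰ 0`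
(`zᵀQz − νg|z|² = [G ⊗ (N⁻¹ − ν1)](z) + ν[(G − g1) ⊗ 1](z)`, `G = [[λc, c], [c, c']]`). So the
no-bus benchmark class under uniform damping also needs NO semidefinite programming.
[cite: VuTuritsyn2016, §III eq. (QKH) and the remark after eq. (Lyapunov); SauerPai1998, §6.10 eqs. (6.238)–(6.241)] -/
def relativeClosedForm (M : μ → ℝ) (Mref lam : ℝ) (E : Matrix κ μ ℝ) (w : κ → ℝ) (δs : κ → ℝ)
    (Ninv : Matrix μ μ ℝ) (c c' ν g : ℝ)
    (hNinv : Ninv * (Matrix.diagonal (fun i => 1 / M i) + Matrix.of (fun _ _ => 1 / Mref)) = 1)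
    (hNinvT : Ninvᵀ = Ninv) (hν : 0 < ν)
    (hNν : (Ninv - ν • (1 : Matrix μ μ ℝ)).PosSemidef) (hw : ∀ k, 0 < w k) (hlam : 0 < lam)
    (hc : 0 < c) (hc' : 0 ≤ c') (hcc' : c ≤ lam * c') (hg : 0 < g) (hg1 : g < lam * c)
    (hg2 : c ^ 2 ≤ (lam * c - g) * (c' - g)) :
    Certificate (System.relativeSwing M Mref lam E w δs) :=
  show Certificate (System.secondOrder (-(lam • (1 : Matrix μ μ ℝ)))
      ((Matrix.diagonal (fun i => 1 / M i) + Matrix.of (fun _ _ => 1 / Mref)) * Eᵀ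
        * Matrix.diagonal w) E δs) from
  ofSecondOrder (-(lam • (1 : Matrix μ μ ℝ)))
    ((Matrix.diagonal (fun i => 1 / M i) + Matrix.of (fun _ _ => 1 / Mref)) * Eᵀ
      * Matrix.diagonal w) E δs
    ((lam * c) • Ninv) (c • Ninv) (c' • Ninv) (fun k => c' * w k) (fun k => c * w k) (ν * g)
    (by rw [Matrix.transpose_smul, hNinvT])
    (by rw [Matrix.transpose_smul, hNinvT])
    (by
      rw [Matrix.mul_neg, Matrix.mul_smul, Matrix.mul_one, smul_smul]
      exact add_neg_cancel _)
    (by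
      have e2 : (Matrix.diagonal fun k => c * w k) = c • Matrix.diagonal w := by
        rw [← Matrix.diagonal_smul]
        rfl
      rw [Matrix.smul_mul, ← Matrix.mul_assoc, ← Matrix.mul_assoc, hNinv, Matrix.one_mul, e2,
        Matrix.mul_smul])
    (by
      have e2 : (Matrix.diagonal fun k => c' * w k) = c' • Matrix.diagonal w := by
        rw [← Matrix.diagonal_smul]
        rfl
      rw [Matrix.smul_mul, ← Matrix.mul_assoc, ← Matrix.mul_assoc, hNinv, Matrix.one_mul, e2,
        Matrix.mul_smul])
    (by
      have hNpsd : Ninv.PosSemidef := by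
        have := hNν.add (Matrix.PosSemidef.one.smul hν.le)
        simpa using this
      have e : -(c • Ninv + (c • Ninv)ᵀ + (-(lam • (1 : Matrix μ μ ℝ)))ᵀ * (c' • Ninv)
          + c' • Ninv * -(lam • (1 : Matrix μ μ ℝ))) = (2 * (lam * c' - c)) • Ninv := by
        rw [Matrix.transpose_smul, hNinvT, Matrix.transpose_neg, Matrix.transpose_smul,
          Matrix.transpose_one, Matrix.neg_mul, Matrix.mul_neg, Matrix.smul_mul, Matrix.one_mul,
          Matrix.mul_smul, Matrix.mul_one, smul_smul]
        ext i j
        simp [Matrix.smul_apply, Matrix.add_apply, Matrix.neg_apply]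
        ring
      rw [e]
      exact hNpsd.smul (by nlinarith))
    (mul_pos hν hg)
    (by
      refine posSemidef_of_transpose_of_nonneg' ?_ fun z => ?_
      · simp only [Matrix.transpose_sub, Matrix.transpose_smul, Matrix.transpose_one,
          Matrix.fromBlocks_transpose, hNinvT]
      · -- atoms
        have hPT : (Ninv - ν • (1 : Matrix μ μ ℝ))ᵀ = Ninv - ν • 1 := by
          rw [Matrix.transpose_sub, Matrix.transpose_smul, Matrix.transpose_one, hNinvT]
        set a : μ → ℝ := z ∘ Sum.inl with ha
        set b : μ → ℝ := z ∘ Sum.inr with hb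
        have sym : b ⬝ᵥ (Ninv *ᵥ a) = a ⬝ᵥ (Ninv *ᵥ b) := by
          rw [Matrix.dotProduct_mulVec, ← Matrix.mulVec_transpose, hNinvT, dotProduct_comm]
        -- the P' = N⁻¹ − ν1 forms
        have hP'form : ∀ u v : μ → ℝ, u ⬝ᵥ ((Ninv - ν • (1 : Matrix μ μ ℝ)) *ᵥ v)
            = u ⬝ᵥ (Ninv *ᵥ v) - ν * (u ⬝ᵥ v) := by
          intro u v
          rw [Matrix.sub_mulVec, Matrix.smul_mulVec, Matrix.one_mulVec, dotProduct_sub,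
            dotProduct_smul, smul_eq_mul]
        have hq := (hNν.dotProduct_mulVec_nonneg ((lam * c) • a + c • b))
        rw [star_trivial, quad_expand hPT, hP'form, hP'form, hP'form] at hq
        have hB3 := hNν.dotProduct_mulVec_nonneg b
        rw [star_trivial, hP'form] at hB3
        -- the coordinate bound
        have hcoord : 0 ≤ (lam * c - g) * (a ⬝ᵥ a) + 2 * c * (a ⬝ᵥ b) + (c' - g) * (b ⬝ᵥ b) := by
          have resh : (lam * c - g) * (a ⬝ᵥ a) + 2 * c * (a ⬝ᵥ b) + (c' - g) * (b ⬝ᵥ b)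
              = ∑ i, ((lam * c - g) * a i ^ 2 + 2 * c * a i * b i + (c' - g) * b i ^ 2) := by
            simp only [dotProduct, Finset.mul_sum, ← Finset.sum_add_distrib]
            refine Finset.sum_congr rfl fun i _ => ?_
            ring
          rw [resh]
          exact Finset.sum_nonneg fun i _ => quadForm₂_nonneg' (by linarith) hg2 (a i) (b i)
        have key1 : c ^ 2 ≤ lam * c * c' := by nlinarith
        have hbr1 : 0 ≤ lam * c * (a ⬝ᵥ (Ninv *ᵥ a) - ν * (a ⬝ᵥ a))
            + 2 * c * (a ⬝ᵥ (Ninv *ᵥ b) - ν * (a ⬝ᵥ b))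
            + c' * (b ⬝ᵥ (Ninv *ᵥ b) - ν * (b ⬝ᵥ b)) := by
          have hlc : 0 < lam * c := mul_pos hlam hc
          by_contra hneg
          rw [not_le] at hneg
          nlinarith [hq, hB3, key1, mul_nonneg (sub_nonneg.2 key1) hB3, hlc,
            mul_neg_of_pos_of_neg hlc hneg]
        -- the goal
        rw [Matrix.transpose_smul, hNinvT, Matrix.sub_mulVec, Matrix.smul_mulVec,
          Matrix.one_mulVec, Matrix.fromBlocks_mulVec, dotProduct_sub, dotProduct_sumElim,
          dotProduct_smul, dotProduct_self_sum]
        simp only [Matrix.smul_mulVec, dotProduct_add, dotProduct_smul,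
          smul_eq_mul, ← ha, ← hb, sym]
        nlinarith [hbr1, hcoord, mul_nonneg hν.le hcoord])
    (fun k => mul_nonneg hc' (hw k).le) (fun k => mul_pos hc (hw k))

end Certificate

namespace Certificate

open ClassicalModel.LosslessSystem (vtGap)

/-- **Solver-free certified synchronization region for the relative (no-bus, uniform-damping)
form.** With the closed-form member `Certificate.relativeClosedForm` (data: exact `N⁻¹`, `ν`,
`c, c', g`), `ker E = 0` (connected network in relative coordinates) and `|δ*_k| < π/2`: for every
`c₀ < V(0) + min_k c'·w_k·vtGap(δ*_k)` the set `{x ∈ 𝒫 : V(x) ≤ c₀}` is positively invariant for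
the relative dynamics and every global solution from it tends to `0` (all machines return to the
reference machine's speed and the equilibrium relative angles). CERTIFIED; only scalar / exact
rational identities on the data remain for an instance. [cite: VuTuritsyn2016, §III eq. (QKH) with §IV (set ℛ); SauerPai1998, §6.10] -/
theorem relativeClosedForm_well_subset_regionOfAttraction (M : μ → ℝ) (Mref lam : ℝ)
    (E : Matrix κ μ ℝ) (w : κ → ℝ) (δs : κ → ℝ) (Ninv : Matrix μ μ ℝ) (c c' ν g : ℝ)
    (hNinv : Ninv * (Matrix.diagonal (fun i => 1 / M i) + Matrix.of (fun _ _ => 1 / Mref)) = 1)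
    (hNinvT : Ninvᵀ = Ninv) (hν : 0 < ν)
    (hNν : (Ninv - ν • (1 : Matrix μ μ ℝ)).PosSemidef) (hw : ∀ k, 0 < w k) (hlam : 0 < lam)
    (hc : 0 < c) (hc' : 0 ≤ c') (hcc' : c ≤ lam * c') (hg : 0 < g) (hg1 : g < lam * c)
    (hg2 : c ^ 2 ≤ (lam * c - g) * (c' - g))
    (hE : ∀ v : μ → ℝ, E *ᵥ v = 0 → v = 0) (hδs : ∀ k, |δs k| < π / 2) {c₀ : ℝ}
    (hc₀ : ∀ k, c₀ < (relativeClosedForm M Mref lam E w δs Ninv c c' ν g hNinv hNinvT hν hNν hw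
      hlam hc hc' hcc' hg hg1 hg2).V 0 + c' * w k * vtGap (δs k))
    {y : μ ⊕ μ → ℝ} (hy : y ∈ (System.relativeSwing M Mref lam E w δs).polytope)
    (hyc : (relativeClosedForm M Mref lam E w δs Ninv c c' ν g hNinv hNinvT hν hNν hw hlam hc hc'
      hcc' hg hg1 hg2).V y ≤ c₀) :
    (∃ X : ℝ → μ ⊕ μ → ℝ, X 0 = y ∧
        ∀ T : ℝ, ∀ t ∈ Icc 0 T,
          HasDerivWithinAt X ((System.relativeSwing M Mref lam E w δs).field (X t)) (Icc 0 T) t) ∧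
      ∀ X : ℝ → μ ⊕ μ → ℝ, X 0 = y →
        (∀ T : ℝ, ∀ t ∈ Icc 0 T,
          HasDerivWithinAt X ((System.relativeSwing M Mref lam E w δs).field (X t)) (Icc 0 T) t) →
        (∀ t, 0 ≤ t → X t ∈ (System.relativeSwing M Mref lam E w δs).polytope ∧
            (relativeClosedForm M Mref lam E w δs Ninv c c' ν g hNinv hNinvT hν hNν hw hlam hc hc'
              hcc' hg hg1 hg2).V (X t) ≤ c₀) ∧
          Tendsto X atTop (𝓝 0) :=
  (relativeClosedForm M Mref lam E w δs Ninv c c' ν g hNinv hNinvT hν hNν hw hlam hc hc' hcc' hg hg1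
      hg2).well_subset_regionOfAttraction_of_gap₀ (System.relativeSwing_C_mul_B M Mref lam E w δs)
    hδs (System.relativeSwing_obs M Mref lam E w δs hE) hc₀ hy hyc

end Certificate

/-! ### `ofSecondOrder` is canonical: the structured hypotheses are NECESSARY (the face of (QKH))

For the second-order structure `A = [[0, I], [0, A_d]]` the FIRST block column of `A` vanishes, so
the `(x₁, x₁)` block of `AᵀQ + QA` is zero; positive semidefiniteness of
`−[[AᵀQ + QA, R], [Rᵀ, −2H]]` then forces the entire `x₁`-rows of that matrix to vanish:
`Q₁₁ + Q₁₂A_d = 0` and `Q₁₂B_a = EᵀH` — exactly the structural hypotheses `h11`, `hH` of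
`Certificate.ofSecondOrder`.  Hence EVERY certificate of the family for a second-order object lies on
this face («the LMI is feasible only on a face», the cell's SDP census), and the only free data are
`Q₂₂`, `K`, `ε` with the two facts `−S ⪰ 0`, `Q − ε1 ⪰ 0`. -/

namespace Certificate

/-- A real positive-semidefinite matrix with a zero diagonal entry has that whole row zero
(`0 ≤ q(t e_i + e_j) = 2t N_ij + N_jj` for all `t`; plumbing). [folklore] -/
private theorem psd_row_eq_zero_of_diag_eq_zero {ρ : Type*} [Fintype ρ] [DecidableEq ρ]
    {N : Matrix ρ ρ ℝ} (hN : N.PosSemidef) {i : ρ} (hi : N i i = 0) (j : ρ) : N i j = 0 := by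
  have hsym : N j i = N i j := by simpa using hN.isHermitian.apply i j
  have hq : ∀ t : ℝ, 0 ≤ 2 * t * N i j + N j j := by
    intro t
    have hw : ∀ a, (N *ᵥ (Pi.single i t + Pi.single j 1)) a = N a i * t + N a j * 1 := by
      intro a
      simp only [Matrix.mulVec, dotProduct_add, dotProduct_single]
    have h := hN.dotProduct_mulVec_nonneg (Pi.single i t + Pi.single j 1)
    rw [star_trivial, add_dotProduct, single_dotProduct, single_dotProduct, hw, hw, hi,
      hsym] at h
    nlinarith [h]
  by_contra hne
  have h := hq (-(N j j + 1) / (2 * N i j))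
  have : 2 * (-(N j j + 1) / (2 * N i j)) * N i j = -(N j j + 1) := by
    field_simp
  linarith

/-- **The face of (QKH) when the FIRST block column of `A` and block row of `B` vanish** (any system
on `μ ⊕ μ'`): every certificate of the family has (i) `Σ_i Q_{x₁a, x₂i} B_{x₂i, k} = h_k C_{k, x₁a}`
and (ii) `Σ_j Q_{x₁a, j} A_{j, x₂b} = 0` — the `x₁`-rows of `[[AᵀQ + QA, R], [Rᵀ, −2H]]` vanish
because its `(x₁, x₁)` block does. [cite: VuTuritsyn2016, §III eq. (QKH) evaluated on §II eq. (3)] -/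
theorem face_of_zero_firstColumn {μ' : Type*} [Fintype μ'] [DecidableEq μ']
    {S : System (μ ⊕ μ') κ} (Λ : Certificate S)
    (hA : ∀ j b, S.A j (Sum.inl b) = 0) (hB : ∀ b k, S.B (Sum.inl b) k = 0) (a : μ) :
    (∀ k, ∑ i, Λ.Q (Sum.inl a) (Sum.inr i) * S.B (Sum.inr i) k = Λ.h k * S.C k (Sum.inl a)) ∧
      ∀ b : μ', ∑ j, Λ.Q (Sum.inl a) j * S.A j (Sum.inr b) = 0 := by
  -- the diagonal entry of the LMI matrix at `x₁a` vanishes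
  have hdiag : (-(Matrix.fromBlocks (S.Aᵀ * Λ.Q + Λ.Q * S.A)
      (Λ.Q * S.B - S.Cᵀ * diagonal Λ.h - (diagonal Λ.kK * S.C * S.A)ᵀ)
      (Λ.Q * S.B - S.Cᵀ * diagonal Λ.h - (diagonal Λ.kK * S.C * S.A)ᵀ)ᵀ
      (-(2 : ℝ) • diagonal Λ.h))) (Sum.inl (Sum.inl a)) (Sum.inl (Sum.inl a)) = 0 := by
    simp [Matrix.fromBlocks_apply₁₁, Matrix.add_apply, Matrix.mul_apply, hA]
  refine ⟨fun k => ?_, fun b => ?_⟩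
  · have hrow := psd_row_eq_zero_of_diag_eq_zero Λ.lmi hdiag (Sum.inr k)
    simp only [Matrix.neg_apply, Matrix.fromBlocks_apply₁₂, neg_eq_zero, Matrix.sub_apply,
      Matrix.transpose_apply] at hrow
    have h1 : (Λ.Q * S.B) (Sum.inl a) k = ∑ i, Λ.Q (Sum.inl a) (Sum.inr i) * S.B (Sum.inr i) k := by
      rw [Matrix.mul_apply, Fintype.sum_sum_type]
      simp [hB]
    have h2 : (S.Cᵀ * diagonal Λ.h) (Sum.inl a) k = S.C k (Sum.inl a) * Λ.h k := by
      rw [Matrix.mul_diagonal, Matrix.transpose_apply]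
    have h3 : (diagonal Λ.kK * S.C * S.A) k (Sum.inl a) = 0 := by
      rw [Matrix.mul_apply]
      exact Finset.sum_eq_zero fun j _ => by rw [hA j, mul_zero]
    rw [h1, h2, h3, sub_zero, sub_eq_zero] at hrow
    rw [hrow, mul_comm]
  · have hrow := psd_row_eq_zero_of_diag_eq_zero Λ.lmi hdiag (Sum.inl (Sum.inr b))
    simp only [Matrix.neg_apply, Matrix.fromBlocks_apply₁₁, neg_eq_zero, Matrix.add_apply] at hrow
    have h1 : (S.Aᵀ * Λ.Q) (Sum.inl a) (Sum.inr b) = 0 := by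
      rw [Matrix.mul_apply]
      exact Finset.sum_eq_zero fun j _ => by rw [Matrix.transpose_apply, hA j, zero_mul]
    rw [h1, zero_add, Matrix.mul_apply] at hrow
    exact hrow

/-- **Necessity of the face, part 1: `Q₁₂B_a = EᵀH`.** For EVERY certificate `(Q, K, H)` of the
family for a second-order object `secondOrder A_d B_a E δ*`,
`Σ_i Q_{x₁a, x₂i}(B_a)_{ik} = h_k E_{ka}` (the `x₁`-row of `R` vanishes) — the hypothesis `hH` of
`Certificate.ofSecondOrder` is necessary. [cite: VuTuritsyn2016, §III eq. (QKH) evaluated on §II eq. (3)] -/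
theorem secondOrder_face_input {Ad : Matrix μ μ ℝ} {Ba : Matrix μ κ ℝ} {E : Matrix κ μ ℝ}
    {δs : κ → ℝ} (Λ : Certificate (System.secondOrder Ad Ba E δs)) (a : μ) (k : κ) :
    ∑ i, Λ.Q (Sum.inl a) (Sum.inr i) * Ba i k = Λ.h k * E k a :=
  (Λ.face_of_zero_firstColumn (fun j b => by rcases j with i | i <;> rfl) (fun _ _ => rfl) a).1 k

/-- **Necessity of the face, part 2: `Q₁₁ + Q₁₂A_d = 0`.** For EVERY certificate of the family for
`secondOrder A_d B_a E δ*`, `Q_{x₁a, x₁b} + Σ_j Q_{x₁a, x₂j}(A_d)_{jb} = 0` (the `(x₁, x₂)` block of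
`AᵀQ + QA` vanishes) — the hypothesis `h11` of `Certificate.ofSecondOrder` is necessary; so every
certificate of a second-order object factors through `ofSecondOrder`'s face, the free data being
`Q₂₂`, `K`, `ε`. [cite: VuTuritsyn2016, §III eq. (QKH) evaluated on §II eq. (3)] -/
theorem secondOrder_face_state {Ad : Matrix μ μ ℝ} {Ba : Matrix μ κ ℝ} {E : Matrix κ μ ℝ}
    {δs : κ → ℝ} (Λ : Certificate (System.secondOrder Ad Ba E δs)) (a b : μ) :
    Λ.Q (Sum.inl a) (Sum.inl b) + ∑ j, Λ.Q (Sum.inl a) (Sum.inr j) * Ad j b = 0 := by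
  have h := (Λ.face_of_zero_firstColumn (fun j b => by rcases j with i | i <;> rfl)
    (fun _ _ => rfl) a).2 b
  rw [Fintype.sum_sum_type] at h
  have e1 : ∀ i : μ, (System.secondOrder Ad Ba E δs).A (Sum.inl i) (Sum.inr b)
      = if i = b then 1 else 0 := by
    intro i
    simp [System.secondOrder, Matrix.one_apply]
  have e2 : ∀ j : μ, (System.secondOrder Ad Ba E δs).A (Sum.inr j) (Sum.inr b) = Ad j b := by
    intro j
    simp [System.secondOrder]
  simp only [e1, e2, mul_ite, mul_one, mul_zero, Finset.sum_ite_eq', Finset.mem_univ,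
    if_true] at h
  exact h

end Certificate

end Literature.MathematicalPhysics.PowerSystems.LyapunovFunctionFamily
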